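import Literature.Geometry.Kaehler.RiemannSurfaceJacobianPolarization
import Literature.Geometry.Kaehler.ComplexTorusSimpleNonAlgebraicSubvarieties
import Literature.Geometry.Kaehler.ComplexTorusAnalyticClassesCodimensionOne
import Literature.Geometry.Kaehler.ComplexTorusAnalyticClassesPrimitiveCriterion
import HarnessLib

/-!
# Hodge classes on the Jacobian of a compact Riemann surface: Lefschetz `(1,1)`, the curve classes,
# and the reduction of the Hodge conjecture for Jacobians of genus `≤ 5` to codimension `2`
# (Lange, *Abelian Varieties over the Complex Numbers*, §7.3; Moonen–Zarhin §5)

Layer `Literature/Geometry/Kaehler`, a bridge between `RiemannSurfaceJacobianPolarization`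
(**`isAbelianVariety_jacobian`**) and the lane's theory of analytic cycle classes on complex tori, which
lives on inner-product models (`ComplexTorusAnalyticClasses…`): the Jacobian `ℂ^g/Π ℤ^{2g}` is moved to
its Euclidean presentation `Ψ = euclideanPresentation Π` (an isomorphic torus, `ComplexTorusSimpleNonAlgebraicSubvarieties`),
which is again an abelian variety, and the lane's theorems for abelian varieties apply — for EVERY genus:

* `isAbelianVariety_euclideanPresentation_periodMatrix`;
* **Lefschetz `(1,1)` for Jacobians** (`analyticClasses_one_jacobian_eq_hodgeClasses`): every Hodge class of
  degree `2` on `Jac(M)` is a `ℚ`-combination of fundamental classes of analytic hypersurfaces, `A¹ = ℬ¹ = 𝒟¹`;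
* **the curve classes** (`analyticClasses_jacobian_eq_hodgeClasses_of_card_eq_succ`): every Hodge class of
  degree `2g - 2` is analytic, `A^{g-1} = ℬ^{g-1}` (Lange §7.3.3 Exercise (2)(b));
* genus `≤ 3`: all `Aᵖ = ℬᵖ`; genus `≤ 5`: `A• = ℬ•` iff `A² = ℬ²` (Moonen–Zarhin §5).

Everything is proved; no named facts, no instances.

## References

* H. Lange, *Abelian Varieties over the Complex Numbers*, Springer (2023), §4.1.2 Prop. 4.1.2, §7.3.1
  (p. 336), §7.3.3 Exercise (2). [Lange2023AbelianVarietiesComplex]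
* B. J. J. Moonen, Yu. G. Zarhin, *Hodge classes on abelian varieties of low dimension*, Math. Ann. 315
  (1999), §5. [MoonenZarhin1999LowDim]
-/

noncomputable section

open scoped Manifold ContDiff Topology
open Set Function Complex Module
open Literature.Topology.CoveringSpaces

namespace Literature.Geometry.Kaehler

namespace RiemannSurface

open MeromorphicOneForm ComplexTorus

universe u

variable {M : Type u} [TopologicalSpace M] [ChartedSpace ℂ M] [ConnectedSpace M] [IsManifold 𝓘(ℂ, ℂ) ω M]
  [IsManifold 𝓘(ℝ, ℂ) ∞ M] [CompactSpace M] [T2Space M] [Fact (Module.finrank ℝ ℂ = 2)]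
  {σ : Type} [Fintype σ] [DecidableEq σ] (w : Module.Basis σ ℂ ↥(holomorphicOneForms M)) (x₀ : M)
  {κ : Type} [Fintype κ] [DecidableEq κ] (c : Module.Basis κ ℤ ↥(periods x₀))

/-- **The Euclidean presentation of the Jacobian is an abelian variety.**
[cite: Lange2023AbelianVarietiesComplex, §4.1.2 Proposition 4.1.2 and §1.1.6 Exercise (5)(b)] -/
theorem isAbelianVariety_euclideanPresentation_periodMatrix :
    IsAbelianVariety (euclideanPresentation (periodMatrix x₀ w c)) :=
  (isAbelianVariety_euclideanPresentation_iff (periodMatrix x₀ w c)).2 (isAbelianVariety_jacobian w x₀ c)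

omit [DecidableEq σ] [Fact (Module.finrank ℝ ℂ = 2)] in
/-- The model of the Euclidean presentation has complex dimension `|σ| = g`.
[cite: Lange2023AbelianVarietiesComplex, §1.1.6 Exercise (5)(b)] -/
theorem finrank_euclideanSpace_fin_finrank_pi :
    finrank ℂ (EuclideanSpace ℂ (Fin (finrank ℂ (σ → ℂ)))) = Fintype.card σ := by
  rw [finrank_euclideanSpace, Fintype.card_fin, Module.finrank_fintype_fun_eq_card]

/-- **Lefschetz `(1,1)` for the Jacobian of every compact connected Riemann surface**: `A¹(Jac(M)) = ℬ¹(Jac(M))`,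
every Hodge class of degree `2` is a rational combination of classes of analytic hypersurfaces.
[cite: Lange2023AbelianVarietiesComplex, §7.3.1 (p. 336) and §2.1 (Appell–Humbert)] -/
theorem analyticClasses_one_jacobian_eq_hodgeClasses :
    analyticClasses (euclideanPresentation (periodMatrix x₀ w c)) (Fintype.equivFin κ).symm 1 =
      hodgeClasses (euclideanPresentation (periodMatrix x₀ w c)) 1 :=
  (isAbelianVariety_euclideanPresentation_periodMatrix w x₀ c).analyticClasses_one_eq_hodgeClasses _ _

/-- `A¹(Jac(M)) = 𝒟¹(Jac(M))` (divisor classes). [cite: Lange2023AbelianVarietiesComplex, §7.3.1 (p. 336)] -/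
theorem analyticClasses_one_jacobian_eq_divisorClasses :
    analyticClasses (euclideanPresentation (periodMatrix x₀ w c)) (Fintype.equivFin κ).symm 1 =
      divisorClasses (euclideanPresentation (periodMatrix x₀ w c)) 1 :=
  (isAbelianVariety_euclideanPresentation_periodMatrix w x₀ c).analyticClasses_one_eq_divisorClasses _ _

/-- **The curve classes: the Hodge `(g-1, g-1)`-conjecture for the Jacobian of every compact connected
Riemann surface of genus `g = p + 1`** — `A^{g-1}(Jac(M)) = ℬ^{g-1}(Jac(M))`.
[cite: Lange2023AbelianVarietiesComplex, §7.3.3 Exercise (2)(b) (p. 341)] -/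
theorem analyticClasses_jacobian_eq_hodgeClasses_of_card_eq_succ {p : ℕ} (hg : Fintype.card σ = p + 1) :
    analyticClasses (euclideanPresentation (periodMatrix x₀ w c)) (Fintype.equivFin κ).symm p =
      hodgeClasses (euclideanPresentation (periodMatrix x₀ w c)) p :=
  (isAbelianVariety_euclideanPresentation_periodMatrix w x₀ c).analyticClasses_eq_hodgeClasses_of_finrank_eq_succ _ _
    (by rw [finrank_euclideanSpace_fin_finrank_pi, hg])

/-- The same with `g = arithGenus M`. [cite: Lange2023AbelianVarietiesComplex, §7.3.3 Exercise (2)(b) (p. 341)] -/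
theorem analyticClasses_jacobian_eq_hodgeClasses_arithGenus_sub_one (hg : 0 < arithGenus M) :
    analyticClasses (euclideanPresentation (periodMatrix x₀ w c)) (Fintype.equivFin κ).symm (arithGenus M - 1) =
      hodgeClasses (euclideanPresentation (periodMatrix x₀ w c)) (arithGenus M - 1) :=
  analyticClasses_jacobian_eq_hodgeClasses_of_card_eq_succ w x₀ c (by rw [card_eq_arithGenus w]; omega)

/-- **Genus `≤ 3`: every Hodge class on `Jac(M)` is analytic**, `Aᵖ = ℬᵖ` for all `p`.
[cite: Lange2023AbelianVarietiesComplex, §7.3.3 Exercise (1)(b), (2)(c)] [cite: MoonenZarhin1999LowDim, §5 (5.2)] -/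
theorem analyticClasses_jacobian_eq_hodgeClasses_of_card_le_three (h3 : Fintype.card σ ≤ 3) (p : ℕ) :
    analyticClasses (euclideanPresentation (periodMatrix x₀ w c)) (Fintype.equivFin κ).symm p =
      hodgeClasses (euclideanPresentation (periodMatrix x₀ w c)) p :=
  (isAbelianVariety_euclideanPresentation_periodMatrix w x₀ c).analyticClasses_eq_hodgeClasses_of_finrank_le_three _ _
    (by rw [finrank_euclideanSpace_fin_finrank_pi]; exact h3) p

/-- **Genus `≤ 5`: the Hodge conjecture (in cycle form) for `Jac(M)` is equivalent to its codimension-`2`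
case** `A²(Jac(M)) = ℬ²(Jac(M))`. [cite: MoonenZarhin1999LowDim, §5 (p0011 L19–L21)] [cite: Lange2023AbelianVarietiesComplex, §7.3.2 (1) and §7.3.3 Exercise (2)] -/
theorem forall_analyticClasses_jacobian_eq_hodgeClasses_iff_two_of_card_le_five (h5 : Fintype.card σ ≤ 5) :
    (∀ p, analyticClasses (euclideanPresentation (periodMatrix x₀ w c)) (Fintype.equivFin κ).symm p =
        hodgeClasses (euclideanPresentation (periodMatrix x₀ w c)) p) ↔
      analyticClasses (euclideanPresentation (periodMatrix x₀ w c)) (Fintype.equivFin κ).symm 2 =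
        hodgeClasses (euclideanPresentation (periodMatrix x₀ w c)) 2 :=
  (isAbelianVariety_euclideanPresentation_periodMatrix w x₀ c).forall_analyticClasses_eq_hodgeClasses_iff_two_of_finrank_le_five
    _ _ (by rw [finrank_euclideanSpace_fin_finrank_pi]; exact h5)

end RiemannSurface

end Literature.Geometry.Kaehler

end
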